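import Mathlib
import Literature.Topology.FourManifolds.TwoHandleTubeDeformationFour
import Literature.Topology.FourManifolds.HandleAttachingMaps
import Literature.Topology.FourManifolds.LefschetzBasePages
import Literature.AlgebraicTopology.SingularHomology.HurewiczOne
import Literature.AlgebraicTopology.FundamentalGroup.CellAttachmentKernelLoop
import Literature.AlgebraicTopology.FundamentalGroup.DeformationRetractInclusion
import HarnessLib

/-!
# The punctured tube of a 4-dimensional 2-handle: its loops are powers of a parallel of the
# attaching circle, and the parallel has the Hurewicz class of the attaching circle
(helper for stub `stub_isLefschetzHandlebody_homology` = NF5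
`Literature.Topology.FourManifolds.LefschetzBase.isLefschetzHandlebody_homology`, line
`modp-braid-orbits` r9, crux `ConvexBisection.AcyclicBisectionExists`, item stmt-SmoothPoincare4-10508;
wave 3 / W3-2: the MODEL half of `H₁(V ∪ 2-handles) = H₁(V)/⟨attaching circles⟩`,
Gompf–Stipsicz 1999 §4.4, for Kosinski multi-attachments of `HandleAttachingMap 3 2`)

Port to dimension four (`handleTube 3 2`, `TwoHandleTubeDeformationFour.lean`) of §1 and §3 of
`TwoHandleAttachmentPi1.lean` (which treats `handleTube 4 2`), in the form consumed by the
Mayer–Vietoris computation of `H₁` of a multi-attachment: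

* §1 `tubeCirclePt c θ = (c θ, 0) ∈ T` (radius clamped to `[1/2, 1]`), the parallel loop
  `parallelLoop = loopPath (tubeCirclePt ½)` and its bookkeeping (it runs on the parallel circle
  `K_{1/2}`, exhausts it, and is simple closed);
* §2 **`exists_fromPath_eq_parallelLoop_zpow`** — every loop of the punctured tube
  `T ∖ S = {|x_λ| ≠ 1}` at the base point of the parallel loop is a power of it in `π₁` (`K_{1/2}`
  is a strong deformation retract of `T ∖ S`, Hatcher Prop. 1.17, and `π₁` of a simple closed
  curve is generated by it, Thm. 1.7) — the hypothesis shape of `range_map_one_eq_span`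
  (`…MultiAttachmentHomologyLoops.lean`);
* §3 **`loopClass_parallel_eq_loopClass_attachingCircle`** — for an attaching map
  `h̄ : T → V`, the loop `h̄ ∘ parallelLoop` and the attaching loop
  `loopPath h̄.attachingCircle` have the same Hurewicz class in `H₁(V; R)` (they are images of one
  loop of `𝕊¹` under homotopic maps `θ ↦ h̄(c θ, 0)`, `c ∈ [1/2, 1]`);
* §4 the registered sub-goal stub `stub_multiAttachment_tubeModel` (§2 ∧ §3).

Everything is proved; no named facts, no `sorry`.  References: A. Hatcher, *Algebraic Topology*
(2002), Thm. 1.7, Prop. 1.17, Thm. 2A.1 [HatcherAT2002]; A. A. Kosinski, *Differential Manifolds*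
(1993), VI §6 [Kosinski1993]; R. E. Gompf, A. I. Stipsicz, *4-Manifolds and Kirby Calculus*
(1999), §4.4 [GompfStipsicz1999].
-/

noncomputable section

-- the prescribed namespace `Summit.<P>.<Sub>.…` duplicates `SmoothPoincare4` (P = Sub)
set_option linter.dupNamespace false

open scoped Manifold ContDiff Topology unitInterval
open Set Function Metric CategoryTheory
open Literature.AlgebraicTopology.SingularHomology Literature.AlgebraicTopology.Homotopy
open Literature.AlgebraicTopology.FundamentalGroup Literature.AlgebraicTopology.FundamentalGroup.VanKampen
open Literature.Topology.FourManifolds Literature.Topology.FourManifolds.HandleShrink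
open Literature.Topology.FourManifolds.LefschetzBase (loopPath)

namespace Summit.SmoothPoincare4.SmoothPoincare4.Theorems.AcyclicBisectionExists.ModpBraidOrbits

universe u v

/-! ## §1 The parallel circles `K_c = {(c θ, 0)}` of the tube `T ⊆ D⁴` -/

/-- The radius, clamped to `[1/2, 1]`. [folklore] -/
private def clampR (c : ℝ) : ℝ := max 2⁻¹ (min c 1)

/-- `1/2 ≤ clampR c`. [folklore] -/
theorem half_le_clampR (c : ℝ) : 2⁻¹ ≤ clampR c := le_max_left _ _

/-- `clampR c ≤ 1`. [folklore] -/
theorem clampR_le_one (c : ℝ) : clampR c ≤ 1 := max_le (by norm_num) (min_le_right _ _)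

/-- `0 < clampR c`. [folklore] -/
theorem clampR_pos (c : ℝ) : 0 < clampR c := lt_of_lt_of_le (by norm_num) (half_le_clampR c)

/-- `clampR` is continuous. [folklore] -/
theorem continuous_clampR : Continuous clampR :=
  continuous_const.max (continuous_id.min continuous_const)

/-- `clampR ½ = ½`. [folklore] -/
@[simp] theorem clampR_half : clampR 2⁻¹ = 2⁻¹ := by norm_num [clampR]

/-- `clampR 1 = 1`. [folklore] -/
@[simp] theorem clampR_one : clampR 1 = 1 := by norm_num [clampR]

/-- **The point `(c θ, 0)` of the parallel circle `K_c ⊆ T`** (`c` clamped to `[1/2, 1]`; for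
`c = 1` this is the point `coreTubePt θ` of the attaching circle `S`). [cite: Kosinski1993, VI §6] -/
private def tubeCirclePt (c : ℝ) (θ : sphere (0 : EuclideanSpace ℝ (Fin 2)) 1) : ↥(handleTube 3 2) :=
  ⟨⟨clampR c • corePt θ, by
      rw [mem_closedBall_zero_iff, norm_smul, norm_corePt, mul_one, Real.norm_eq_abs,
        abs_of_pos (clampR_pos c)]
      exact clampR_le_one c⟩, by
    rw [mem_handleTube]
    show lamSq 2 (clampR c • corePt θ) ≠ 0
    rw [lamSq_smul, lamSq_corePt, mul_one]
    exact (pow_pos (clampR_pos c) 2).ne'⟩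

/-- The underlying vector of `tubeCirclePt c θ` is `clampR c • corePt θ`. [folklore] -/
@[simp] theorem coe_coe_tubeCirclePt (c : ℝ) (θ : sphere (0 : EuclideanSpace ℝ (Fin 2)) 1) :
    (tubeCirclePt c θ).1.1 = clampR c • corePt θ := rfl

/-- `|·|_λ² = c²` on `K_c`. [folklore] -/
theorem lamSq_tubeCirclePt (c : ℝ) (θ : sphere (0 : EuclideanSpace ℝ (Fin 2)) 1) :
    lamSq 2 (tubeCirclePt c θ).1.1 = clampR c ^ 2 := by
  rw [coe_coe_tubeCirclePt, lamSq_smul, lamSq_corePt, mul_one]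

/-- `x_μ = 0` on `K_c`. [folklore] -/
theorem muSq_tubeCirclePt (c : ℝ) (θ : sphere (0 : EuclideanSpace ℝ (Fin 2)) 1) :
    muSq 2 (tubeCirclePt c θ).1.1 = 0 := by
  rw [coe_coe_tubeCirclePt, ← blockScale_self_eq_smul, muSq_blockScale, muSq_corePt, mul_zero]

/-- `K_c` misses the attaching circle `S = {|x_λ| = 1}` for `c < 1`, in particular for `c = ½`.
[folklore] -/
theorem lamSq_tubeCirclePt_half_ne_one (θ : sphere (0 : EuclideanSpace ℝ (Fin 2)) 1) :
    lamSq 2 (tubeCirclePt 2⁻¹ θ).1.1 ≠ 1 := by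
  rw [lamSq_tubeCirclePt, clampR_half]; norm_num

/-- `tubeCirclePt 1 θ` is the point `coreTubePt θ` of the attaching circle. [folklore] -/
theorem tubeCirclePt_one (θ : sphere (0 : EuclideanSpace ℝ (Fin 2)) 1) :
    tubeCirclePt 1 θ = coreTubePt θ := by
  apply Subtype.ext; apply Subtype.ext
  rw [coe_coe_tubeCirclePt, clampR_one, one_smul, coe_coe_coreTubePt]

/-- `(c, θ) ↦ tubeCirclePt c θ` is jointly continuous. [folklore] -/
theorem continuous_tubeCirclePt :
    Continuous fun p : ℝ × sphere (0 : EuclideanSpace ℝ (Fin 2)) 1 => tubeCirclePt p.1 p.2 :=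
  (((continuous_clampR.comp continuous_fst).smul
    (continuous_corePt.comp continuous_snd)).subtype_mk _).subtype_mk _

/-- Every point of `K_{clampR c}` is `tubeCirclePt c θ` for the point `θ = x_λ/c ∈ S¹`. [folklore] -/
theorem exists_tubeCirclePt_eq (c : ℝ) {y : ↥(handleTube 3 2)} (hl : lamSq 2 y.1.1 = clampR c ^ 2)
    (hm : muSq 2 y.1.1 = 0) : ∃ θ, tubeCirclePt c θ = y := by
  set u : EuclideanSpace ℝ (Fin 4) := y.1.1 with hu
  have hc := clampR_pos c
  have h2 : u 2 = 0 := apply_eq_zero_of_muSq_eq_zero hm (i := 2) (by norm_num)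
  have h3 : u 3 = 0 := apply_eq_zero_of_muSq_eq_zero hm (i := 3) (by norm_num)
  rw [lamSq_two_fin_four] at hl
  let v : EuclideanSpace ℝ (Fin 2) := WithLp.toLp 2 ![u 0 / clampR c, u 1 / clampR c]
  have hv : ‖v‖ = 1 := by
    have : ‖v‖ ^ 2 = 1 := by
      rw [EuclideanSpace.norm_sq_eq, Fin.sum_univ_two, Real.norm_eq_abs, Real.norm_eq_abs,
        sq_abs, sq_abs]
      simp only [v]
      rw [Matrix.cons_val_zero, Matrix.cons_val_one, Matrix.cons_val_zero, div_pow, div_pow,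
        ← add_div, hl, div_self (pow_pos hc 2).ne']
    nlinarith [norm_nonneg v]
  refine ⟨⟨v, mem_sphere_zero_iff_norm.2 hv⟩, ?_⟩
  apply Subtype.ext; apply Subtype.ext
  rw [coe_coe_tubeCirclePt]
  ext i
  fin_cases i
  · show clampR c * (u 0 / clampR c) = u 0
    field_simp
  · show clampR c * (u 1 / clampR c) = u 1
    field_simp
  · show clampR c * 0 = u 2
    rw [h2, mul_zero]
  · show clampR c * 0 = u 3
    rw [h3, mul_zero]

/-- Every point of `S¹` is `circlePt t` for some `t ∈ [0, 1]`. [folklore] -/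
theorem exists_circlePt_eq (θ : sphere (0 : EuclideanSpace ℝ (Fin 2)) 1) : ∃ t : I, circlePt t = θ := by
  obtain ⟨t, ht⟩ := mem_range_euclideanCircleLoop ⟨(θ : EuclideanSpace ℝ (Fin 2)),
    mem_closedBall_zero_iff.2 (norm_eq_of_mem_sphere θ).le⟩ (norm_eq_of_mem_sphere θ)
  refine ⟨t, Subtype.ext ?_⟩
  have ht' := congrArg (fun x : closedBall (0 : EuclideanSpace ℝ (Fin 2)) 1 =>
    (x : EuclideanSpace ℝ (Fin 2))) ht
  simp only [euclideanCircleLoop_apply_coe] at ht'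
  rw [← ht']
  ext i
  fin_cases i
  · simp [circlePt_apply_zero]
  · simp [circlePt_apply_one]

/-- `circlePt` is injective on `[0, 1]` except for `circlePt 0 = circlePt 1`. [folklore] -/
theorem circlePt_eq_iff (s t : I) (h : circlePt s = circlePt t) :
    s = t ∨ (s = 0 ∧ t = 1) ∨ (s = 1 ∧ t = 0) := by
  apply euclideanCircleLoop_eq_iff
  apply Subtype.ext
  rw [euclideanCircleLoop_apply_coe, euclideanCircleLoop_apply_coe]
  have h0 := congrArg (fun θ : sphere (0 : EuclideanSpace ℝ (Fin 2)) 1 =>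
    (θ : EuclideanSpace ℝ (Fin 2)) 0) h
  have h1 := congrArg (fun θ : sphere (0 : EuclideanSpace ℝ (Fin 2)) 1 =>
    (θ : EuclideanSpace ℝ (Fin 2)) 1) h
  simp only [circlePt_apply_zero, circlePt_apply_one] at h0 h1
  ext i
  fin_cases i
  · simpa using h0
  · simpa using h1

/-! ## §2 Loops of the punctured tube are powers of the parallel loop -/

/-- **The parallel loop** `t ↦ (½ cos 2πt, ½ sin 2πt, 0, 0)` of the tube, once around the parallel
circle `K_{1/2}`. [cite: Kosinski1993, VI §6] -/
private def parallelLoop : Path (tubeCirclePt 2⁻¹ (circlePt 0)) (tubeCirclePt 2⁻¹ (circlePt 0)) :=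
  loopPath (tubeCirclePt 2⁻¹) (continuous_tubeCirclePt.comp (Continuous.prodMk_right _))

/-- The parallel loop on points. [folklore] -/
@[simp] theorem parallelLoop_apply (t : I) : parallelLoop t = tubeCirclePt 2⁻¹ (circlePt t) := rfl

/-- The punctured tube `T ∖ S = {|x_λ| ≠ 1}`. [cite: Kosinski1993, VI §6] -/
private def puncturedTube : Set ↥(handleTube 3 2) := {y | lamSq 2 y.1.1 ≠ 1}

/-- The parallel circle `K_{1/2} = {|x_λ| = ½, x_μ = 0}`. [cite: Kosinski1993, VI §6] -/
private def parallelCircle : Set ↥(handleTube 3 2) :=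
  {y | lamSq 2 y.1.1 = (2⁻¹ : ℝ) ^ 2 ∧ muSq 2 y.1.1 = 0}

/-- The parallel loop runs on the parallel circle. [folklore] -/
theorem parallelLoop_mem_parallelCircle (t : I) : parallelLoop t ∈ parallelCircle := by
  refine ⟨?_, muSq_tubeCirclePt _ _⟩
  show lamSq 2 (tubeCirclePt 2⁻¹ (circlePt t)).1.1 = _
  rw [lamSq_tubeCirclePt, clampR_half]

/-- The parallel circle lies in the punctured tube. [folklore] -/
theorem parallelCircle_subset_puncturedTube : parallelCircle ⊆ puncturedTube := by
  rintro y ⟨hy, -⟩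
  show lamSq 2 y.1.1 ≠ 1
  rw [hy]; norm_num

/-- The parallel loop runs in the punctured tube. [folklore] -/
theorem parallelLoop_mem_puncturedTube (t : I) : parallelLoop t ∈ puncturedTube :=
  parallelCircle_subset_puncturedTube (parallelLoop_mem_parallelCircle t)

/-- The base point of the parallel loop lies in the punctured tube. [folklore] -/
theorem base_mem_puncturedTube : tubeCirclePt 2⁻¹ (circlePt 0) ∈ puncturedTube :=
  lamSq_tubeCirclePt_half_ne_one _

/-- The base point of the parallel loop lies on the parallel circle. [folklore] -/
theorem base_mem_parallelCircle : tubeCirclePt 2⁻¹ (circlePt 0) ∈ parallelCircle := by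
  simpa using parallelLoop_mem_parallelCircle 0

/-- The parallel loop exhausts the parallel circle. [folklore] -/
theorem parallelCircle_subset_range_parallelLoop : parallelCircle ⊆ range parallelLoop := by
  rintro y ⟨hl, hm⟩
  obtain ⟨θ, rfl⟩ := exists_tubeCirclePt_eq 2⁻¹ (by rwa [clampR_half]) hm
  obtain ⟨t, rfl⟩ := exists_circlePt_eq θ
  exact ⟨t, rfl⟩

/-- The parallel loop is simple closed (injective on `[0, 1)`). [folklore] -/
theorem parallelLoop_eq_iff (s t : I) (h : parallelLoop s = parallelLoop t) :
    s = t ∨ (s = 0 ∧ t = 1) ∨ (s = 1 ∧ t = 0) := by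
  apply circlePt_eq_iff
  have h1 := congrArg (fun y : ↥(handleTube 3 2) => y.1.1) h
  simp only [parallelLoop_apply, coe_coe_tubeCirclePt] at h1
  exact injective_corePt (smul_right_injective _ (clampR_pos 2⁻¹).ne' h1)

/-- **Every loop of the punctured tube `T ∖ S` at the base point of the parallel loop is a power
of the parallel loop in `π₁(T ∖ S)`**: `K_{1/2}` is a strong deformation retract of `T ∖ S`
(`isStrongDeformationRetractOf_parallel₄_of_lt`), so `π₁(K_{1/2}) → π₁(T ∖ S)` is onto
(Hatcher Prop. 1.17), and `π₁` of the simple closed curve `K_{1/2}` is generated by the parallel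
loop (Thm. 1.7). [cite: HatcherAT2002, Thm. 1.7 and Prop. 1.17] -/
theorem exists_fromPath_eq_parallelLoop_zpow
    (γ : Path (⟨tubeCirclePt 2⁻¹ (circlePt 0), base_mem_puncturedTube⟩ : ↥puncturedTube)
      ⟨tubeCirclePt 2⁻¹ (circlePt 0), base_mem_puncturedTube⟩) :
    ∃ n : ℤ, FundamentalGroup.fromPath (Path.Homotopic.Quotient.mk γ) =
      FundamentalGroup.fromPath (Path.Homotopic.Quotient.mk
        (liftPath puncturedTube parallelLoop parallelLoop_mem_puncturedTube)) ^ n := by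
  -- `π₁(K, b)` is generated by the parallel loop
  have hgen := zpowers_liftPath_eq_top_of_simpleClosed parallelLoop parallelLoop_eq_iff
    parallelLoop_mem_parallelCircle parallelCircle_subset_range_parallelLoop base_mem_parallelCircle
  -- `π₁(K, b) → π₁(T ∖ S, b)` is onto
  have hsdr : IsStrongDeformationRetractOf parallelCircle puncturedTube :=
    isStrongDeformationRetractOf_parallel₄_of_lt (c := 2⁻¹) (by norm_num) (by norm_num)
  have hsurj := (bijective_inclHomOfSubset_of_isStrongDeformationRetractOf hsdr
    parallelCircle_subset_puncturedTube base_mem_parallelCircle).2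
  obtain ⟨c, hc⟩ := hsurj (FundamentalGroup.fromPath (Path.Homotopic.Quotient.mk γ))
  have hc' : c ∈ Subgroup.zpowers (FundamentalGroup.fromPath (Path.Homotopic.Quotient.mk
      (liftPath parallelCircle parallelLoop parallelLoop_mem_parallelCircle))) := by
    rw [hgen]; exact Subgroup.mem_top c
  obtain ⟨n, rfl⟩ := Subgroup.mem_zpowers_iff.1 hc'
  refine ⟨n, ?_⟩
  rw [← hc, map_zpow, inclHomOfSubset_fromPath_liftPath]

/-! ## §3 The parallel loop has the Hurewicz class of the attaching circle -/

section Hurewicz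

variable (R : Type v) [CommRing R] {V : Type u} [TopologicalSpace V]

/-- Loops that agree as maps `[0, 1] → V` have the same Hurewicz class (no base-point
bookkeeping). [folklore] -/
theorem loopClass_congr_coe {x y : V} (γ : Path x x) (γ' : Path y y) (h : (γ : I → V) = γ') :
    loopClass R R (1 : R) γ = loopClass R R (1 : R) γ' := by
  apply loopClass_eq_of_ofPath_eq
  obtain rfl : x = y := by simpa using congrFun h 0
  rw [show γ = γ' from Path.ext h]

/-- The circle, lifted to the universe of `V` (singular homology is functorial within one
universe). [folklore] -/
private abbrev LCircle : Type u := ULift.{u} ↥(sphere (0 : EuclideanSpace ℝ (Fin 2)) 1)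

/-- A map of the circle read on the lifted circle. [folklore] -/
private def liftCircleMap (K : C(sphere (0 : EuclideanSpace ℝ (Fin 2)) 1, V)) : C(LCircle.{u}, V) :=
  K.comp ⟨ULift.down, continuous_uliftDown⟩

/-- The Hurewicz class of the unit-period loop of `K : 𝕊¹ → V` is `K_*` of that of the
unit-period loop of the (lifted) circle (naturality `K_* h(ω) = h(K ∘ ω)`). [cite: HatcherAT2002, Thm. 2A.1] -/
theorem loopClass_loopPath_eq_map (K : C(sphere (0 : EuclideanSpace ℝ (Fin 2)) 1, V)) :
    loopClass R R (1 : R) (loopPath K K.continuous) =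
      singularHomology.map R R (liftCircleMap K) 1 (loopClass R R (1 : R)
        (loopPath (ULift.up : sphere (0 : EuclideanSpace ℝ (Fin 2)) 1 → LCircle.{u})
          continuous_uliftUp)) := by
  rw [map_loopClass]
  exact loopClass_congr_coe R _ _ (funext fun _ => rfl)

/-- **Homotopic maps of the circle have unit-period loops with the same Hurewicz class**
(naturality and homotopy invariance of `K_*`). [cite: HatcherAT2002, Thm. 2A.1] -/
theorem loopClass_loopPath_eq_of_homotopic {K₀ K₁ : C(sphere (0 : EuclideanSpace ℝ (Fin 2)) 1, V)}
    (h : K₀.Homotopic K₁) :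
    loopClass R R (1 : R) (loopPath K₀ K₀.continuous) =
      loopClass R R (1 : R) (loopPath K₁ K₁.continuous) := by
  have h' : (liftCircleMap K₀).Homotopic (liftCircleMap K₁) :=
    h.comp (ContinuousMap.Homotopic.refl _)
  rw [loopClass_loopPath_eq_map, loopClass_loopPath_eq_map, singularHomology.map_eq_of_homotopic R R h']

variable [ChartedSpace (EuclideanHalfSpace (3 + 1)) V]

/-- The loop `h̄ ∘ (c θ, 0)` of an attaching map over the parallel circle `K_c`, as a map of `𝕊¹`.
[cite: Kosinski1993, VI §6] -/
private def tubeCircleMap (g : HandleAttachingMap 3 2 V) (c : ℝ) :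
    C(sphere (0 : EuclideanSpace ℝ (Fin 2)) 1, V) :=
  ⟨fun θ => g.toFun (tubeCirclePt c θ),
    g.continuous.comp (continuous_tubeCirclePt.comp (Continuous.prodMk_right c))⟩

/-- `tubeCircleMap g c θ = h̄ (c θ, 0)`. [folklore] -/
@[simp] theorem tubeCircleMap_apply (g : HandleAttachingMap 3 2 V) (c : ℝ)
    (θ : sphere (0 : EuclideanSpace ℝ (Fin 2)) 1) : tubeCircleMap g c θ = g.toFun (tubeCirclePt c θ) :=
  rfl

/-- At `c = 1` the loop over `K_1 = S` is the attaching circle. [folklore] -/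
theorem tubeCircleMap_one (g : HandleAttachingMap 3 2 V) :
    tubeCircleMap g 1 = ⟨g.attachingCircle, g.continuous_attachingCircle⟩ := by
  ext θ
  show g.toFun (tubeCirclePt 1 θ) = g.toFun (coreTubePt θ)
  rw [tubeCirclePt_one]

/-- **The radial homotopy `(r, θ) ↦ h̄(((1 + r)/2) θ, 0)` inside the tube** from the parallel
`h̄ ∘ K_{1/2}` to the attaching circle `h̄ ∘ K_1`. [cite: Kosinski1993, VI §6] -/
private def tubeCircleHomotopy (g : HandleAttachingMap 3 2 V) :
    (tubeCircleMap g 2⁻¹).Homotopy ⟨g.attachingCircle, g.continuous_attachingCircle⟩ where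
  toFun p := g.toFun (tubeCirclePt ((1 + (p.1 : ℝ)) / 2) p.2)
  continuous_toFun := g.continuous.comp (continuous_tubeCirclePt.comp
    ((((continuous_const.add (continuous_subtype_val.comp continuous_fst)).div_const _)).prodMk
      continuous_snd))
  map_zero_left θ := by
    show g.toFun (tubeCirclePt ((1 + 0) / 2) θ) = g.toFun (tubeCirclePt 2⁻¹ θ)
    norm_num
  map_one_left θ := by
    show g.toFun (tubeCirclePt ((1 + 1) / 2) θ) = g.toFun (coreTubePt θ)
    rw [← tubeCirclePt_one]; norm_num

/-- **The parallel loop `h̄ ∘ parallelLoop` has the Hurewicz class of the attaching loop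
`loopPath h̄.attachingCircle` in `H₁(V; R)`.** [cite: HatcherAT2002, Thm. 2A.1] -/
theorem loopClass_parallel_eq_loopClass_attachingCircle (g : HandleAttachingMap 3 2 V) :
    loopClass R R (1 : R) (parallelLoop.map g.continuous) =
      loopClass R R (1 : R) (loopPath g.attachingCircle g.continuous_attachingCircle) := by
  have h := loopClass_loopPath_eq_of_homotopic R ⟨tubeCircleHomotopy g⟩
  exact h

end Hurewicz


/-! ## §4 The registered sub-goal stub -/

/-- **The tube model of the multi-attachment `H₁` engine** (registered sub-goal stub
`stub_multiAttachment_tubeModel` of `stub_isLefschetzHandlebody_homology`): there is a loop `L`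
in the punctured tube `T ∖ S = {|x_λ| ≠ 1}` of a 4-dimensional 2-handle (the parallel
`K_{1/2}` of the attaching circle, once around) such that (i) every loop of `T ∖ S` at its base
point is a power of `L` in `π₁(T ∖ S)`, and (ii) for every attaching map `h̄ : T → V` the loop
`h̄ ∘ L` has the Hurewicz class of the attaching loop `loopPath h̄.attachingCircle` in `H₁(V; R)`.
With `range_map_one_eq_span` this identifies the image of `H₁` of the gluing region
`jA(V ∖ ⋃ cores) ∩ jBᵢ(D⁴ ∖ S) ≅ T ∖ S` of the `i`-th handle as the span of the `i`-th attaching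
class (Gompf–Stipsicz 1999, §4.4). [cite: HatcherAT2002, Thm. 1.7, Prop. 1.17, Thm. 2A.1] -/
theorem stub_multiAttachment_tubeModel :
    ∃ (y₀ : ↥{y : ↥(Literature.Topology.FourManifolds.handleTube 3 2) |
        Literature.Topology.FourManifolds.lamSq 2 y.1.1 ≠ 1}) (L : Path y₀ y₀),
      (∀ γ : Path y₀ y₀, ∃ n : ℤ, FundamentalGroup.fromPath (Path.Homotopic.Quotient.mk γ) =
        FundamentalGroup.fromPath (Path.Homotopic.Quotient.mk L) ^ n) ∧
      ∀ (R : Type) [CommRing R] (V : Type) [TopologicalSpace V]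
        [ChartedSpace (EuclideanHalfSpace (3 + 1)) V]
        (h : Literature.Topology.FourManifolds.HandleAttachingMap 3 2 V),
        Literature.AlgebraicTopology.SingularHomology.loopClass R R (1 : R)
            (L.map (h.continuous.comp continuous_subtype_val)) =
          Literature.AlgebraicTopology.SingularHomology.loopClass R R (1 : R)
            (Literature.Topology.FourManifolds.LefschetzBase.loopPath h.attachingCircle
              h.continuous_attachingCircle) := by
  refine ⟨⟨tubeCirclePt 2⁻¹ (circlePt 0), base_mem_puncturedTube⟩,
    liftPath puncturedTube parallelLoop parallelLoop_mem_puncturedTube,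
    exists_fromPath_eq_parallelLoop_zpow, fun R _ V _ _ h => ?_⟩
  rw [← loopClass_parallel_eq_loopClass_attachingCircle R h]
  exact loopClass_congr_coe R _ _ (funext fun _ => rfl)

end Summit.SmoothPoincare4.SmoothPoincare4.Theorems.AcyclicBisectionExists.ModpBraidOrbits
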